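import Summits.ResolutionOfSingularities.ResolutionOfSingularities.Theorems.EquisingularLiftEquisingularLiftNatD4Vertices
import Summits.ResolutionOfSingularities.ResolutionOfSingularities.Theorems.EquisingularLiftEquisingularLiftNatVertexNotRegular
import HarnessLib

/-!
# [OURS] `D₄` VERTICES OVER AN ALGEBRAICALLY CLOSED FIELD OF CHARACTERISTIC `≠ 2, 3`: the splitting of `t³ + 1` and the non-regularity of the vertex
# discharged — a prime surface `V₊(F) ⊆ ℙ³_K̄` whose singular points are singular one-step vertices or `D₄` vertices `y₀² + (y₁³ + y₂³)` satisfies `IsoHypPoint`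
# (cruxes `Theses.EquisingularLift.EquisingularLiftNat` / `…NatThree` / `EquisingularLift`, stmt-ResolutionOfSingularities-20038 / -20148 / -15660)

[OURS · leafhand-res-equisingularlift-12 g0, 2026-08-31; cell `pub/decomp-res`] AI-produced, weaker than expert review; NOT a statement of any manuscript;
nothing here proves resolution of singularities in positive characteristic.  DEF-FREE helper; no `sorry`; standard axioms; ZERO named hypotheses.

* `SecondOrderPoint.exists_split_X_cube_add_one` — `K` algebraically closed: there are `ζ₀, ζ₁, ζ₂` (namely `−1, −ω, −ω²`, `ω² + ω + 1 = 0`) with `ζ_k³ = −1` and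
  `(T − ζ₀)(T − ζ₁)(T − ζ₂) = T³ + 1` in `K[T₀, T₁, T₂]` for each variable — the hypotheses `hζ`, `hfac` of ✓ `twoStepData_D₄_marked'` / ✓ `isoHypPoint_of_D₄Vertices`;
* ★★★ `isoHypPoint_of_D₄Vertices'` — `K = K̄` with `2 ≠ 0`, `3 ≠ 0`; `F ∈ K[x₀,…,x₃]` a prime form; `S₁` SINGULAR one-step vertices (`μ ≥ 2`), `S₂` vertices with chart
  `y₀² + (y₁³ + y₂³)`; the `S₁` charts singular at most at the origin; the unmarked charts regular.  Then `IsoHypPoint K (1+2) V₊(F) ι` — ✓ `isoHypPoint_of_D₄Vertices`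
  with `exists_split_X_cube_add_one` and the vertex non-regularity ✓ `not_isRegularLocalRing_stalk_vertex` (p-landed, …NatVertexNotRegular).

Honest label: closes no registered stub (certifies `D₄` configurations OUTSIDE the isolated residual's `¬ IsoHypPoint`).

References: [Hartshorne1977, I Thm. 5.1, I Ex. 5.6, II Ex. 7.12]; [Matsumura1987, Thm. 14.2]; [StacksProject, Tag 080E]; through the cited tree files.
-/

set_option linter.dupNamespace false -- mandated namespace `Summit.<Summit>.<Problem>` of this single-conjunct summit

noncomputable section

open CategoryTheory CategoryTheory.Limits AlgebraicGeometry TopologicalSpace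
open Literature.AlgebraicGeometry.Resolution Literature.AlgebraicGeometry.Motives
open AlgebraicGeometry.Scheme.IdealSheafData
open MvPolynomial HomogeneousLocalization
open Literature.AlgebraicGeometry.Motives.SmoothHypersurface Literature.AlgebraicGeometry.Motives.ProjectiveSpace
open Summit.ResolutionOfSingularities.ResolutionOfSingularities.Cruxes.EquisingularLift.StrataSplit

namespace Summit.ResolutionOfSingularities.ResolutionOfSingularities.Cruxes.EquisingularLiftNat.Sections

/-- **`t³ + 1` splits over an algebraically closed field**, with roots `−1, −ω, −ω²` (`ω² + ω + 1 = 0`), each of cube `−1`; stated in `K[T₀, T₁, T₂]` for every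
variable. [folklore] -/
theorem SecondOrderPoint.exists_split_X_cube_add_one (K : Type) [Field K] [IsAlgClosed K] :
    ∃ ζ : Fin 3 → K, (∀ k, ζ k ^ 3 = -1) ∧
      ∀ i : Fin 3, ((X i - C (ζ 0)) * (X i - C (ζ 1)) * (X i - C (ζ 2)) : MvPolynomial (Fin 3) K) = X i ^ 3 + 1 := by
  have hdeg : (Polynomial.X ^ 2 + Polynomial.X + 1 : Polynomial K).degree = 2 := by
    compute_degree!
  obtain ⟨ω, hω⟩ := IsAlgClosed.exists_root (Polynomial.X ^ 2 + Polynomial.X + 1 : Polynomial K) (by rw [hdeg]; norm_num)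
  have hω' : ω ^ 2 + ω + 1 = 0 := by
    have h := hω
    simp only [Polynomial.IsRoot, Polynomial.eval_add, Polynomial.eval_pow, Polynomial.eval_X, Polynomial.eval_one] at h
    exact h
  have hω3 : ω ^ 3 = 1 := by linear_combination (ω - 1) * hω'
  refine ⟨![-1, -ω, -ω ^ 2], fun k => ?_, fun i => ?_⟩
  · fin_cases k
    · simp only [Fin.zero_eta, Matrix.cons_val_zero]
      norm_num
    · simp only [Fin.mk_one, Matrix.cons_val_one, Matrix.cons_val_zero]
      linear_combination (-1 : K) * hω3
    · simp only [Fin.reduceFinMk, Matrix.cons_val]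
      linear_combination (-(ω ^ 3) - 1) * hω3
  · have hC : (C ω : MvPolynomial (Fin 3) K) ^ 2 + C ω + 1 = 0 := by
      have h := congrArg (C : K →+* MvPolynomial (Fin 3) K) hω'
      rwa [map_add, map_add, map_pow, map_one, map_zero] at h
    simp only [Matrix.cons_val_zero, Matrix.cons_val_one, Matrix.cons_val, map_neg, map_pow, map_one, sub_neg_eq_add]
    linear_combination (X i ^ 2 + C ω * X i + (C ω - 1)) * hC

/-- ★★★ **SEVERAL SINGULAR ONE-STEP AND `D₄` VERTICES OF A PRIME SURFACE OVER `K̄` (`char ≠ 2, 3`) ⟹ `IsoHypPoint`**, hypothesis-light form of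
✓ `isoHypPoint_of_D₄Vertices`: the cube roots and the non-regularity of the marked vertices are discharged. [OURS] [cite: Hartshorne1977, I Thm. 5.1, I Ex. 5.6]
[cite: Matsumura1987, Thm. 14.2] [cite: StacksProject, Tag 080E] -/
theorem isoHypPoint_of_D₄Vertices' (K : Type) [Field K] [IsAlgClosed K] (h2 : (2 : K) ≠ 0) (h3 : (3 : K) ≠ 0)
    (F : MvPolynomial (Fin (1 + 2 + 1)) K) {d : ℕ} (hF : F.IsHomogeneous d) (hFp : Prime F)
    (S₁ S₂ : List (Fin (1 + 2 + 1)))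
    (hone : ∀ c ∈ S₁, ∃ (μ : ℕ) (Φ Ψ : MvPolynomial (Fin (1 + 2)) K), 2 ≤ μ ∧ Φ.IsHomogeneous μ ∧ Φ ≠ 0 ∧
      Ψ ∈ Ideal.span (Set.range (X : Fin (1 + 2) → MvPolynomial (Fin (1 + 2)) K)) ^ (μ + 1) ∧ ProjectiveSpace.dehomogenize K c F = Φ + Ψ ∧
      ∀ l : Fin (1 + 2), ∃ G : MvPolynomial (Fin (1 + 2)) K,
        aeval (fun j => X l * Function.update (X : Fin (1 + 2) → MvPolynomial (Fin (1 + 2)) K) l 1 j) (Φ + Ψ) = X l ^ μ * G ∧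
        ∀ P : Ideal (MvPolynomial (Fin (1 + 2)) K), P.IsPrime → (X l : MvPolynomial (Fin (1 + 2)) K) ∈ P → G ∈ P → ∃ j, pderiv j G ∉ P)
    (hD₄ : ∀ c ∈ S₂, ProjectiveSpace.dehomogenize K c F = X 0 ^ 2 + (X 1 ^ 3 + X 2 ^ 3))
    (hsing₁ : ∀ c ∈ S₁, ∀ P : Ideal (MvPolynomial (Fin (1 + 2)) K), P.IsPrime → ProjectiveSpace.dehomogenize K c F ∈ P →
      (∀ j, pderiv j (ProjectiveSpace.dehomogenize K c F) ∈ P) → ∀ j, (X j : MvPolynomial (Fin (1 + 2)) K) ∈ P)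
    (hoff : letI := MvPolynomial.gradedAlgebra (σ := Fin (1 + 2 + 1)) (R := K)
      ∀ c, c ∉ S₁ → c ∉ S₂ → IsRegularRing (ChartRing F c hF)) :
    letI := MvPolynomial.gradedAlgebra (σ := Fin (1 + 2 + 1)) (R := K)
    IsoHypPoint K (1 + 2) (hypersurface F).left (hypersurfaceι F).left := by
  obtain ⟨ζ, hζ, hfac⟩ := SecondOrderPoint.exists_split_X_cube_add_one K
  refine isoHypPoint_of_D₄Vertices K h2 h3 ζ hζ hfac F hF hFp S₁ S₂ (fun c hc => ?_) hD₄ hsing₁ (fun c hc => ?_) hoff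
  · obtain ⟨μ, Φ, Ψ, hμ, hΦ, hΦ0, hΨ, hdeh, hG⟩ := hone c hc
    exact ⟨μ, Φ, Ψ, by omega, hΦ, hΦ0, hΨ, hdeh, hG⟩
  · rcases hc with hc | hc
    · obtain ⟨μ, Φ, Ψ, hμ, hΦ, -, hΨ, hdeh, -⟩ := hone c hc
      exact not_isRegularLocalRing_stalk_vertex K F hF hFp c ⟨μ, Φ, Ψ, hμ, hΦ, hΨ, hdeh⟩
    · exact not_isRegularLocalRing_stalk_vertex K F hF hFp c
        ⟨2, X 0 ^ 2, X 1 ^ 3 + X 2 ^ 3, le_rfl, isHomogeneous_X_pow (0 : Fin 3) 2, SecondOrderPoint.D₄_tail_mem_pow K, hD₄ c hc⟩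

end Summit.ResolutionOfSingularities.ResolutionOfSingularities.Cruxes.EquisingularLiftNat.Sections

end
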